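import Summits.BirchSwinnertonDyer.BirchSwinnertonDyer.Theorems.ManinLocalTwoThreeCDivisionTranslateSigns
import Summits.BirchSwinnertonDyer.BirchSwinnertonDyer.Theorems.ManinLocalTwoThreeUnboundedDenominatorsWeightOfCDT
import Summits.BirchSwinnertonDyer.BirchSwinnertonDyer.Theorems.ManinLocalTwoThreeLevelFreeTwistTransport
import Summits.BirchSwinnertonDyer.BirchSwinnertonDyer.Theorems.EisensteinDepletionAtTwoStarDoubleLiftFalse
import Literature.NumberTheory.EllipticCurves.ModularParamIntegralityProofs
import HarnessLib

/-!
# The GALOIS ENGINE: an automorphism of `ℂ` fixes the three half-period values `℘_{Λ_W}(α)` in the index-`4` configuration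
(route `ManinLocalTwoThree`, crux C2 `ManinOddAtFour` stmt-BirchSwinnertonDyer-22967; cell bsd-f2-manin, prover p3 gen 19; brick 4 of the kernel
port of E-an-152d in the `2 ∣ c₀` form: index `4` ∧ `|c₀| = 2` ⟹ full rational `2`-torsion)

THE ARGUMENT.  `Λ₀(f)/Λ_W = {0, α, β, γ}` (`α + β ≡ γ`); `A = F₀ + F_α − F_β − F_γ` (translates of the `c`-division witness) is a `Γ₀(N)`-eigenfunction with
the sign character `χ` of kernel `{0, α}` (`…TranslateSigns.slash_combination`), trivial on `Γ₁(N)` in the index-`4` world (`Λ₁(f) ⊆ Λ_W`).  ANCHOR HYPOTHESIS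
(discharged separately by `η`-quotients and Montgomery–Vaughan 9.13): every such sign character `χ` of `Γ₀(N)` admits a nowhere-vanishing holomorphic `g`,
bounded at all cusps, with RATIONAL `q`-expansion and `g ∣ δ = χ(δ)g` on some `Γ₀(N')`, `N ∣ N'`.  Then `Z = A·g·Δ ∈ S_K(Γ₀(N'))`; for `σ ∈ Aut ℂ` the
conjugate `Z^σ ∈ S_K(Γ₀(N'))` (Shimura 3.52 integral basis, tree `exists_basis_int_cuspCoeff` / `cuspCoeff_equivFun_symm_conj_gamma0`) has the
`q`-expansion of `A'·g·Δ`, `A' = F₀ + F_{α'} − F_{β'} − F_{γ'}` where `σ℘(α) = ℘(α')` etc. (the expansions of the translates are polynomial over `ℚ` in the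
half-period values, `…Translates`); so `A'gΔ = Z^σ` is `Γ₀(N')`-invariant — but under `δ ∈ Γ₀(N')` of period class `α` it picks up the sign `χ'(δ)χ(δ) = −1`
unless `α' ≡ α`; as `A'gΔ ≢ 0`, `α' ≡ α`, i.e. **`σ` fixes `℘_{Λ_W}(α)`**.
* `exists_cuspForm_of_data`, `exists_conj_cuspForm`, `hasSum_cuspCoeff`, `cuspCoeff_eq_of_hasSum`, `exists_gamma0_mul_level_cuspSymbol_sub_mem` —
  packaging tools on `Γ₀(N')`;
* `false_of_conj_moves_class` — the core contradiction; `ringEquiv_apply_weierstrassP_eq` — **`σ(℘_{Λ_W} α) = ℘_{Λ_W} α`** for each class `α`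
  of a triple, GIVEN the anchor hypothesis (stated inline, no definition).
HONEST FRAMING: E-an-152d is NOT yet discharged here (the anchor hypothesis is an explicit binder); C2, Manin's conjecture and BSD are NOT proved.
No definitions, no sorry. [cite: ShimuraIATAF1971, Thm. 3.52] [cite: Manin1972, Prop. 1.4] [cite: Lawden1989, §6.8 eq. (6.8.11)]
-/

set_option autoImplicit false
-- lint-debt: the directory name repeats the summit name (sibling precedent `ManinLocalTwoThreeCDivisionTranslateSigns.lean`)
set_option linter.dupNamespace false

noncomputable section

open scoped Topology PeriodPair MatrixGroups ModularForm Manifold Classical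
open Complex Filter PowerSeries CongruenceSubgroup
open UpperHalfPlane hiding I
open WeierstrassCurve Literature.NumberTheory.EllipticCurves Literature.NumberTheory.EllipticCurves.ModularForms

namespace Summit.BirchSwinnertonDyer.BirchSwinnertonDyer.Theorems.ManinLocalTwoThree.CDivTranslate

/-! ## §1 Packaging tools on `Γ₀(N')` -/

/-- A holomorphic `Γ₀(N')`-invariant function of weight `K` vanishing at every cusp IS a cusp form. [folklore] -/
theorem exists_cuspForm_of_data (N' : ℕ) [NeZero N'] (Kz : ℤ) (Z : ℍ → ℂ) (hhol : MDifferentiable 𝓘(ℂ) 𝓘(ℂ) Z)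
    (hinv : ∀ γ ∈ Gamma0 N', Z ∣[Kz] γ = Z) (hzero : ∀ δ : SL(2, ℤ), IsZeroAtImInfty (Z ∣[Kz] δ)) :
    ∃ Zf : CuspForm (Gamma0 N') Kz, ⇑Zf = Z := by
  refine ⟨{ toFun := Z
            slash_action_eq' := fun A hA ↦ ?_
            holo' := hhol
            zero_at_cusps' := fun {c} hc ↦ ?_ }, rfl⟩
  · obtain ⟨γ, hγ, rfl⟩ := hA
    exact hinv γ hγ
  · rw [Subgroup.IsArithmetic.isCusp_iff_isCusp_SL2Z] at hc
    rw [OnePoint.isZeroAt_iff_forall_SL2Z hc]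
    intro γ _
    exact hzero γ

/-- **The conjugate of a cusp form on `Γ₀(N')` by a ring endomorphism `σ` of `ℂ`** (coordinates in an integral basis, Shimura Thm. 3.52):
a cusp form with Fourier coefficients `σ(aₙ)`. [cite: ShimuraIATAF1971, Thm. 3.52] -/
theorem exists_conj_cuspForm {N' : ℕ} [NeZero N'] {Kz : ℤ} (hK : 2 ≤ Kz) (Zf : CuspForm (Gamma0 N') Kz) (σ : ℂ →+* ℂ) :
    ∃ Zσ : CuspForm (Gamma0 N') Kz, ∀ n, cuspCoeff Zσ n = σ (cuspCoeff Zf n) := by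
  obtain ⟨r, gb, hgb⟩ := exists_basis_int_cuspCoeff N' Kz hK
  exact ⟨gb.equivFun.symm fun i ↦ σ (gb.equivFun Zf i), fun n ↦ cuspCoeff_equivFun_symm_conj_gamma0 gb hgb σ Zf n⟩

/-- The `q`-expansion of a cusp form on `Γ₀(N')` sums to it everywhere. [folklore] -/
theorem hasSum_cuspCoeff {N' : ℕ} [NeZero N'] {Kz : ℤ} (Zf : CuspForm (Gamma0 N') Kz) (τ : ℍ) :
    HasSum (fun n : ℕ ↦ cuspCoeff Zf n * Function.Periodic.qParam 1 (τ : ℂ) ^ n) (Zf τ) := by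
  have h := UpperHalfPlane.hasSum_qExpansion one_pos
    (SlashInvariantFormClass.periodic_comp_ofComplex Zf (one_mem_strictPeriods_coe_gamma0 N'))
    (ModularFormClass.holo Zf) (ModularFormClass.bdd_at_infty Zf) τ
  convert h using 2 with m
  rw [cuspCoeff, smul_eq_mul]

/-- **Coefficient identification**: if `Σ cₙ 𝕢τⁿ = Z_f(τ)` high in the cusp, then `aₙ(Z_f) = cₙ` (extension to all of `ℍ` by the tree's
`QExpansionExtension.hasSum_of_hasSum_of_lt_im`, then Mathlib's uniqueness of `q`-expansion coefficients). [folklore] -/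
theorem cuspCoeff_eq_of_hasSum {N' : ℕ} [NeZero N'] {Kz : ℤ} (Zf : CuspForm (Gamma0 N') Kz) {c : ℕ → ℂ} {B : ℝ}
    (hs : ∀ τ : ℍ, B < τ.im → HasSum (fun n : ℕ ↦ c n * Function.Periodic.qParam 1 (τ : ℂ) ^ n) (Zf τ)) (n : ℕ) :
    cuspCoeff Zf n = c n := by
  have hall : ∀ τ : ℍ, HasSum (fun m : ℕ ↦ c m • Function.Periodic.qParam 1 (τ : ℂ) ^ m) (Zf τ) := fun τ ↦ by
    simpa [smul_eq_mul] using QExpansionExtension.hasSum_of_hasSum_of_lt_im (ModularFormClass.holo Zf) hs τ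
  rw [cuspCoeff]
  exact (ModularFormClass.qExpansion_coeff_unique one_pos (one_mem_strictPeriods_coe_gamma0 N') (f := Zf) hall n).symm

/-- **From `Γ₀(N)` to `Γ₀(N')`**: for `N ∣ N'` and `γ ∈ Γ₀(N)` there is `γ₀ ∈ Γ₀(N')` with the same lower-right entry modulo `N`, hence
`{∞, γ₀∞}_f − {∞, γ∞}_f ∈ Λ₁(f)` (units lift along `(ℤ/N')ˣ ↠ (ℤ/N)ˣ`). [cite: Stevens1989, §2] -/
theorem exists_gamma0_mul_level_cuspSymbol_sub_mem {N : ℕ} [NeZero N] (f : CuspForm (Gamma0 N) 2) {N' : ℕ} [NeZero N'] (hNN' : N ∣ N')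
    (γ : Gamma0 N) : ∃ γ₀ : SL(2, ℤ), ∃ h₀ : γ₀ ∈ Gamma0 N', cuspSymbol f ⟨γ₀, maninLocalTwoThree_mem_gamma0_of_dvd hNN' h₀⟩ - cuspSymbol f γ ∈ periodLatticeGamma1 f := by
  have hunit : IsUnit ((((γ : SL(2, ℤ)) 1 1 : ℤ) : ZMod N)) :=
    IsUnit.of_mul_eq_one_right _ (apply_zero_zero_mul_apply_one_one γ)
  obtain ⟨u', hu'⟩ := ZMod.unitsMap_surjective hNN' hunit.unit
  obtain ⟨γ₀, hγ₀⟩ := exists_gamma0_apply_one_one_eq_of_isUnit (N := N') (a := ((u' : (ZMod N')ˣ) : ZMod N')) u'.isUnit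
  refine ⟨(γ₀ : SL(2, ℤ)), γ₀.2, cuspSymbol_sub_mem_periodLatticeGamma1_of_apply_eq f γ ⟨γ₀, maninLocalTwoThree_mem_gamma0_of_dvd hNN' γ₀.2⟩ ?_⟩
  show (((γ : SL(2, ℤ)) 1 1 : ℤ) : ZMod N) = (((γ₀ : SL(2, ℤ)) 1 1 : ℤ) : ZMod N)
  have h1 : (((γ₀ : SL(2, ℤ)) 1 1 : ℤ) : ZMod N) = ZMod.castHom hNN' (ZMod N) ((((γ₀ : SL(2, ℤ)) 1 1 : ℤ) : ZMod N')) := by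
    rw [map_intCast]
  rw [h1, hγ₀, ZMod.castHom_apply, ← ZMod.unitsMap_val hNN' u', hu']
  rfl

/-! ## §2 The core contradiction -/

/-- **The core of the Galois engine.**  In the index-`4` configuration (`Λ₁(f) ⊆ Λ_W ⊇ 2Λ₀(f)`, classes `0, α, β, γ` with `α + β ≡ γ`), GIVEN the anchor
hypothesis for sign characters of `Γ₀(N)`: if an automorphism `σ` of `ℂ` moves `℘_{Λ_W}(α)` to `℘_{Λ_W}(α')` for a triple `(α', β', γ')` of classes with
`{σ℘(β), σ℘(γ)} = {℘(β'), ℘(γ')}`, then `α' ≡ α (mod Λ_W)`.  Proof in the module docstring. [cite: ShimuraIATAF1971, Thm. 3.52] [cite: Manin1972, Prop. 1.4] -/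
theorem false_of_conj_moves_class {N : ℕ} [NeZero N] {W : WeierstrassCurve ℚ} [W.IsElliptic] [W.IsGloballyMinimal]
    (D : ModularParametrizationData W N)
    (hΛ₁ : ∀ z ∈ periodLatticeGamma1 D.f, z ∈ D.L.lattice) (h2 : ∀ w ∈ periodLattice D.f, 2 * w ∈ D.L.lattice)
    (hAnchor : ∀ χ : SL(2, ℤ) → ℤ,
      (∀ γ ∈ Gamma0 N, χ γ = 1 ∨ χ γ = -1) → (∀ γ ∈ Gamma0 N, ∀ δ ∈ Gamma0 N, χ (γ * δ) = χ γ * χ δ) →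
      (∀ γ ∈ Gamma0 N, ((γ 1 1 : ℤ) : ZMod N) = 1 → χ γ = 1) → (∀ γ ∈ Gamma0 N, γ 1 0 = 0 → χ γ = 1) →
      ∃ (N' : ℕ) (kg : ℤ) (g : ℍ → ℂ) (cg : ℕ → ℚ), N ∣ N' ∧ 0 < N' ∧ MDifferentiable 𝓘(ℂ) 𝓘(ℂ) g ∧
        (∀ δ : SL(2, ℤ), IsBoundedAtImInfty (g ∣[kg] δ)) ∧ (∀ γ ∈ Gamma0 N', g ∣[kg] γ = ((χ γ : ℤ) : ℂ) • g) ∧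
        (∀ τ : ℍ, HasSum (fun n : ℕ ↦ ((cg n : ℚ) : ℂ) * Function.Periodic.qParam 1 (τ : ℂ) ^ n) (g τ)) ∧ (∀ τ : ℍ, g τ ≠ 0))
    {α β γ : ℂ} (hα : α ∈ periodLattice D.f) (hβ : β ∈ periodLattice D.f) (hγ : γ ∈ periodLattice D.f)
    (hαW : α ∉ D.L.lattice) (hβW : β ∉ D.L.lattice) (hγW : γ ∉ D.L.lattice)
    (hαβ : α - β ∉ D.L.lattice) (hαγ : α - γ ∉ D.L.lattice) (hsum : α + β - γ ∈ D.L.lattice)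
    (hcover : ∀ w ∈ periodLattice D.f, w ∈ D.L.lattice ∨ w - α ∈ D.L.lattice ∨ w - β ∈ D.L.lattice ∨ w - γ ∈ D.L.lattice)
    {α' β' γ' : ℂ} (hα' : α' ∈ periodLattice D.f) (hβ' : β' ∈ periodLattice D.f) (hγ' : γ' ∈ periodLattice D.f)
    (hα'W : α' ∉ D.L.lattice) (hβ'W : β' ∉ D.L.lattice) (hγ'W : γ' ∉ D.L.lattice)
    (hα'β' : α' - β' ∉ D.L.lattice) (hα'γ' : α' - γ' ∉ D.L.lattice) (hsum' : α' + β' - γ' ∈ D.L.lattice)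
    (hcover' : ∀ w ∈ periodLattice D.f, w ∈ D.L.lattice ∨ w - α' ∈ D.L.lattice ∨ w - β' ∈ D.L.lattice ∨ w - γ' ∈ D.L.lattice)
    (σ : ℂ ≃+* ℂ) (hσα : σ (℘[D.L] α) = ℘[D.L] α')
    (hσβγ : (σ (℘[D.L] β) = ℘[D.L] β' ∧ σ (℘[D.L] γ) = ℘[D.L] γ') ∨ (σ (℘[D.L] β) = ℘[D.L] γ' ∧ σ (℘[D.L] γ) = ℘[D.L] β'))
    (hne : α - α' ∉ D.L.lattice) : False := by
  obtain ⟨K, a, k, G, Fw, gF, 𝒮, _hK, _ha2, hG0, _hGint, hT1, hT2, hT3, hT4, hpres, hF0s, hFws, h𝒮σ⟩ := exists_translateFamily W D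
  -- the sign character of the triple `(α, β, γ)`
  set χ : SL(2, ℤ) → ℤ := fun δ ↦ if h : δ ∈ Gamma0 N then
    (if cuspSymbol D.f ⟨δ, h⟩ ∈ D.L.lattice ∨ cuspSymbol D.f ⟨δ, h⟩ - α ∈ D.L.lattice then 1 else -1) else 1 with hχ
  have hχval : ∀ (δ : SL(2, ℤ)) (h : δ ∈ Gamma0 N), χ δ =
      (if cuspSymbol D.f ⟨δ, h⟩ ∈ D.L.lattice ∨ cuspSymbol D.f ⟨δ, h⟩ - α ∈ D.L.lattice then 1 else -1) := fun δ h ↦ by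
    rw [hχ]; simp only [dif_pos h]
  have hχ1 : ∀ δ ∈ Gamma0 N, χ δ = 1 ∨ χ δ = -1 := fun δ h ↦ by
    rw [hχval δ h]; split_ifs <;> simp
  have hχmul : ∀ δ ∈ Gamma0 N, ∀ δ' ∈ Gamma0 N, χ (δ * δ') = χ δ * χ δ' := by
    intro δ hδ δ' hδ'
    rw [hχval δ hδ, hχval δ' hδ', hχval (δ * δ') (Subgroup.mul_mem _ hδ hδ')]
    have hm : cuspSymbol D.f ⟨δ * δ', Subgroup.mul_mem _ hδ hδ'⟩ = cuspSymbol D.f ⟨δ, hδ⟩ + cuspSymbol D.f ⟨δ', hδ'⟩ :=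
      cuspSymbol_mul_holds D.f ⟨δ, hδ⟩ ⟨δ', hδ'⟩
    rw [hm]
    exact sign_add D h2 hα hβ hγ hβW hγW hαβ hαγ hsum hcover (AddSubgroup.subset_closure ⟨⟨δ, hδ⟩, rfl⟩)
      (AddSubgroup.subset_closure ⟨⟨δ', hδ'⟩, rfl⟩)
  have hχΓ₁ : ∀ δ ∈ Gamma0 N, ((δ 1 1 : ℤ) : ZMod N) = 1 → χ δ = 1 := fun δ hδ hd ↦ by
    rw [hχval δ hδ, if_pos (Or.inl (hΛ₁ _ (cuspSymbol_mem_periodLatticeGamma1_of_apply_eq_one D.f ⟨δ, hδ⟩ hd)))]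
  have hχc0 : ∀ δ ∈ Gamma0 N, δ 1 0 = 0 → χ δ = 1 := fun δ hδ hc ↦ by
    rw [hχval δ hδ]
    have : cuspSymbol D.f ⟨δ, hδ⟩ = 0 := by rw [cuspSymbol]; exact if_pos hc
    rw [this]; exact if_pos (Or.inl (zero_mem _))
  obtain ⟨N', kg, g, cg, hNN', hN'pos, hghol, hgbdd, hgslash, hgsum, hgne⟩ := hAnchor χ hχ1 hχmul hχΓ₁ hχc0
  haveI : NeZero N' := ⟨hN'pos.ne'⟩
  -- the combinations and their eigen-relations
  have hAslash := slash_combination D Fw hT3 hT4 h2 hα hβ hγ hβW hγW hαβ hαγ hsum hcover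
  have hA'slash := slash_combination D Fw hT3 hT4 h2 hα' hβ' hγ' hβ'W hγ'W hα'β' hα'γ' hsum' hcover'
  have h0Λ : (0 : ℂ) ∈ periodLattice D.f := zero_mem _
  have hAhol : ∀ {x y z : ℂ}, x ∈ periodLattice D.f → y ∈ periodLattice D.f → z ∈ periodLattice D.f →
      MDifferentiable 𝓘(ℂ) 𝓘(ℂ) (Fw 0 + Fw x - Fw y - Fw z) := fun hx hy hz ↦
    (((hT1 0 h0Λ).add (hT1 _ hx)).sub (hT1 _ hy)).sub (hT1 _ hz)
  have hAbdd : ∀ {x y z : ℂ}, x ∈ periodLattice D.f → y ∈ periodLattice D.f → z ∈ periodLattice D.f →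
      ∀ δ : SL(2, ℤ), IsBoundedAtImInfty ((Fw 0 + Fw x - Fw y - Fw z) ∣[K] δ) := by
    intro x y z hx hy hz δ
    simp only [sub_eq_add_neg, SlashAction.add_slash, SlashAction.neg_slash]
    exact (((hT2 0 h0Λ δ).add (hT2 x hx δ)).add (hT2 y hy δ).neg).add (hT2 z hz δ).neg
  -- the exponent `b` and the weight
  set b : ℕ := (2 - K - kg).toNat + 1 with hb
  have hKz2 : 2 ≤ K + kg + 12 * (b : ℤ) := by
    rw [hb]; push_cast
    rcases le_or_gt 0 (2 - K - kg) with h | h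
    · rw [Int.toNat_of_nonneg h]; omega
    · rw [Int.toNat_eq_zero.mpr h.le]; omega
  set Δb : ℍ → ℂ := fun τ ↦ ModularForm.discriminant τ ^ b with hΔb
  have hΔbhol : MDifferentiable 𝓘(ℂ) 𝓘(ℂ) Δb := (CuspForm.discriminant).holo'.pow b
  have hΔbslash : ∀ A : SL(2, ℤ), Δb ∣[(12 * (b : ℤ))] A = Δb := fun A ↦ UDWOfCDT.discriminant_pow_slash b A
  have hΔbzero : IsZeroAtImInfty Δb := by
    have hΔ : Tendsto (ModularForm.discriminant : ℍ → ℂ) atImInfty (𝓝 0) := CuspFormClass.zero_at_infty CuspForm.discriminant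
    have hb0 : b ≠ 0 := by rw [hb]; omega
    have h := hΔ.pow b
    rw [zero_pow hb0] at h
    exact h
  -- generic packaging of `X·g·Δ^b` for an eigen-combination `X` with the character `χ`
  have hpack : ∀ (X : ℍ → ℂ), MDifferentiable 𝓘(ℂ) 𝓘(ℂ) X → (∀ δ : SL(2, ℤ), IsBoundedAtImInfty (X ∣[K] δ)) →
      (∀ δ ∈ Gamma0 N', X ∣[K] δ = ((χ δ : ℤ) : ℂ) • X) →
      ∃ Zf : CuspForm (Gamma0 N') (K + kg + 12 * (b : ℤ)), ⇑Zf = X * g * Δb := by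
    intro X hXhol hXbdd hXslash
    refine exists_cuspForm_of_data N' _ _ ((hXhol.mul hghol).mul hΔbhol) (fun δ hδ ↦ ?_) (fun δ ↦ ?_)
    · rw [ModularForm.mul_slash_SL2, ModularForm.mul_slash_SL2, hXslash δ hδ, hgslash δ hδ, hΔbslash]
      have hsq : ((χ δ : ℤ) : ℂ) * ((χ δ : ℤ) : ℂ) = 1 := by
        rcases hχ1 δ (maninLocalTwoThree_mem_gamma0_of_dvd hNN' hδ) with h | h <;> rw [h] <;> norm_num
      funext τ
      simp only [Pi.mul_apply, Pi.smul_apply, smul_eq_mul]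
      linear_combination (X τ * g τ * Δb τ) * hsq
    · rw [ModularForm.mul_slash_SL2, ModularForm.mul_slash_SL2, hΔbslash]
      exact ((hXbdd δ).mul (hgbdd δ)).mul_zeroAtFilter hΔbzero
  -- `Z = A·g·Δ^b` is a cusp form of level `N'`
  have hχA : ∀ δ ∈ Gamma0 N', (Fw 0 + Fw α - Fw β - Fw γ) ∣[K] δ = ((χ δ : ℤ) : ℂ) • (Fw 0 + Fw α - Fw β - Fw γ) := by
    intro δ hδ
    have hδN : δ ∈ Gamma0 N := maninLocalTwoThree_mem_gamma0_of_dvd hNN' hδ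
    rw [hχval δ hδN]
    exact hAslash ⟨δ, hδN⟩
  obtain ⟨Zf, hZf⟩ := hpack _ (hAhol hα hβ hγ) (hAbdd hα hβ hγ) hχA
  -- the series: `g`, `Δ^b`, `A`, `A'`
  set Cg : ℂ⟦X⟧ := (PowerSeries.mk cg).map (algebraMap ℚ ℂ) with hCg
  set Dser : ℂ⟦X⟧ := (((X * formalDeltaUnit) ^ b : ℤ⟦X⟧)).map (Int.castRingHom ℂ) with hDser
  have hgsum' : ∀ τ : ℍ, HasSum (fun n : ℕ ↦ coeff n Cg * Function.Periodic.qParam 1 (τ : ℂ) ^ n) (g τ) := fun τ ↦ by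
    convert hgsum τ using 2 with n
    rw [hCg, coeff_map, coeff_mk]; rfl
  have hΔbsum : ∀ τ : ℍ, HasSum (fun n : ℕ ↦ coeff n Dser * Function.Periodic.qParam 1 (τ : ℂ) ^ n) (Δb τ) := fun τ ↦ by
    have h := CDivCuspGerm.hasSum_intCoeff_pow (Literature.NumberTheory.EllipticCurves.hasSum_X_mul_formalDeltaUnit τ) b
    convert h using 2 with n
    rw [hDser, coeff_map, eq_intCast]
  have hCgσ : Cg.map (σ : ℂ →+* ℂ) = Cg := by
    ext n; rw [hCg, coeff_map, coeff_map, coeff_mk, eq_ratCast, map_ratCast]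
  have hDσ : Dser.map (σ : ℂ →+* ℂ) = Dser := by
    ext n; simp only [hDser, coeff_map, eq_intCast, map_intCast]
  have hgFσ : (gF.map (algebraMap ℚ ℂ)).map (σ : ℂ →+* ℂ) = gF.map (algebraMap ℚ ℂ) := by
    ext n; rw [coeff_map, coeff_map, eq_ratCast, map_ratCast]
  set PA : ℂ⟦X⟧ := gF.map (algebraMap ℚ ℂ) + 𝒮 (℘[D.L] α) - 𝒮 (℘[D.L] β) - 𝒮 (℘[D.L] γ) with hPA
  set PA' : ℂ⟦X⟧ := gF.map (algebraMap ℚ ℂ) + 𝒮 (℘[D.L] α') - 𝒮 (℘[D.L] β') - 𝒮 (℘[D.L] γ') with hPA'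
  have hPAσ : PA.map (σ : ℂ →+* ℂ) = PA' := by
    rw [hPA, hPA', map_sub, map_sub, map_add, hgFσ, h𝒮σ, h𝒮σ, h𝒮σ]
    show gF.map (algebraMap ℚ ℂ) + 𝒮 (σ (℘[D.L] α)) - 𝒮 (σ (℘[D.L] β)) - 𝒮 (σ (℘[D.L] γ)) = _
    rw [hσα]
    rcases hσβγ with ⟨h1, h2'⟩ | ⟨h1, h2'⟩
    · rw [h1, h2']
    · rw [h1, h2']; ring
  -- series of `Z` and identification of its coefficients
  have hseries : ∀ {x y z : ℂ}, x ∈ periodLattice D.f → y ∈ periodLattice D.f → z ∈ periodLattice D.f →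
      x ∉ D.L.lattice → y ∉ D.L.lattice → z ∉ D.L.lattice → ∃ B : ℝ, ∀ τ : ℍ, B < τ.im →
      HasSum (fun n : ℕ ↦ coeff n ((gF.map (algebraMap ℚ ℂ) + 𝒮 (℘[D.L] x) - 𝒮 (℘[D.L] y) - 𝒮 (℘[D.L] z)) * Cg * Dser) *
        Function.Periodic.qParam 1 (τ : ℂ) ^ n) (((Fw 0 + Fw x - Fw y - Fw z) * g * Δb) τ) := by
    intro x y z hx hy hz hxW hyW hzW
    obtain ⟨B, hB⟩ := exists_hasSum_combination D Fw gF 𝒮 hF0s hFws h2 hx hy hz hxW hyW hzW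
    refine ⟨B, fun τ hτ ↦ ?_⟩
    have h1 := Summit.BirchSwinnertonDyer.BirchSwinnertonDyer.Theorems.ManinLocalTwoThree.KummerCubeSigmaLeaves.hasSum_coeff_mul_pow_mul
      (hB τ hτ) (hgsum' τ)
    exact Summit.BirchSwinnertonDyer.BirchSwinnertonDyer.Theorems.ManinLocalTwoThree.KummerCubeSigmaLeaves.hasSum_coeff_mul_pow_mul
      h1 (hΔbsum τ)
  obtain ⟨B₁, hB₁⟩ := hseries hα hβ hγ hαW hβW hγW
  have hcoef : ∀ n, cuspCoeff Zf n = coeff n (PA * Cg * Dser) :=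
    cuspCoeff_eq_of_hasSum Zf (fun τ hτ ↦ by rw [hZf]; exact hB₁ τ hτ)
  -- the conjugate form and the function `Z' = A'·g·Δ^b`
  obtain ⟨Zσ, hZσ⟩ := exists_conj_cuspForm hKz2 Zf (σ : ℂ →+* ℂ)
  have hZσsum : ∀ τ : ℍ, HasSum (fun n : ℕ ↦ coeff n (PA' * Cg * Dser) * Function.Periodic.qParam 1 (τ : ℂ) ^ n) (Zσ τ) := by
    intro τ
    convert hasSum_cuspCoeff Zσ τ using 2 with n
    rw [hZσ n, hcoef n]
    congr 1
    rw [← coeff_map, (PowerSeries.map (σ : ℂ →+* ℂ)).map_mul, (PowerSeries.map (σ : ℂ →+* ℂ)).map_mul, hPAσ, hCgσ, hDσ]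
  obtain ⟨B₂, hB₂⟩ := hseries hα' hβ' hγ' hα'W hβ'W hγ'W
  have hZ'hol : MDifferentiable 𝓘(ℂ) 𝓘(ℂ) ((Fw 0 + Fw α' - Fw β' - Fw γ') * g * Δb) := ((hAhol hα' hβ' hγ').mul hghol).mul hΔbhol
  have hZ'eq : (Fw 0 + Fw α' - Fw β' - Fw γ') * g * Δb = ⇑Zσ := by
    funext τ
    exact (QExpansionExtension.hasSum_of_hasSum_of_lt_im hZ'hol hB₂ τ).unique (hZσsum τ)
  -- an element of `Γ₀(N')` in the class of `α`
  obtain ⟨γα, hγα⟩ := DepletionAtTwo.EvenBranch.exists_cuspSymbol_eq_of_mem_periodLattice D.f hα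
  obtain ⟨γ₀, hγ₀, hγ₀α⟩ := exists_gamma0_mul_level_cuspSymbol_sub_mem D.f hNN' γα
  rw [hγα] at hγ₀α
  have hP₀ : cuspSymbol D.f ⟨γ₀, maninLocalTwoThree_mem_gamma0_of_dvd hNN' hγ₀⟩ - α ∈ D.L.lattice := hΛ₁ _ hγ₀α
  -- signs at `γ₀`: `χ γ₀ = 1`, `A' ∣ γ₀ = −A'`
  have hχγ₀ : χ γ₀ = 1 := by rw [hχval γ₀ (maninLocalTwoThree_mem_gamma0_of_dvd hNN' hγ₀), if_pos (Or.inr hP₀)]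
  have hA'γ₀ : (Fw 0 + Fw α' - Fw β' - Fw γ') ∣[K] γ₀ = (-1 : ℂ) • (Fw 0 + Fw α' - Fw β' - Fw γ') := by
    have h := hA'slash ⟨γ₀, maninLocalTwoThree_mem_gamma0_of_dvd hNN' hγ₀⟩
    have hneg : ¬ (cuspSymbol D.f ⟨γ₀, maninLocalTwoThree_mem_gamma0_of_dvd hNN' hγ₀⟩ ∈ D.L.lattice ∨
        cuspSymbol D.f ⟨γ₀, maninLocalTwoThree_mem_gamma0_of_dvd hNN' hγ₀⟩ - α' ∈ D.L.lattice) := by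
      rintro (h' | h')
      · exact hαW (by have := sub_mem h' hP₀; rwa [sub_sub_cancel] at this)
      · exact hne (by have := sub_mem h' hP₀; have e : cuspSymbol D.f ⟨γ₀, maninLocalTwoThree_mem_gamma0_of_dvd hNN' hγ₀⟩ - α' -
          (cuspSymbol D.f ⟨γ₀, maninLocalTwoThree_mem_gamma0_of_dvd hNN' hγ₀⟩ - α) = α - α' := (by ring); rwa [e] at this)
    rw [if_neg hneg] at h
    simpa using h
  -- `Z' ∣ γ₀ = −Z'` but `Z' = Zσ` is `Γ₀(N')`-invariant
  have hZ'neg : ((Fw 0 + Fw α' - Fw β' - Fw γ') * g * Δb) ∣[K + kg + 12 * (b : ℤ)] γ₀ =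
      -((Fw 0 + Fw α' - Fw β' - Fw γ') * g * Δb) := by
    rw [ModularForm.mul_slash_SL2, ModularForm.mul_slash_SL2, hA'γ₀, hgslash γ₀ hγ₀, hχγ₀, hΔbslash]
    funext τ
    simp only [Pi.mul_apply, Pi.smul_apply, Pi.neg_apply, smul_eq_mul, Int.cast_one, one_mul, neg_mul]
  have hZ'inv : ((Fw 0 + Fw α' - Fw β' - Fw γ') * g * Δb) ∣[K + kg + 12 * (b : ℤ)] γ₀ = (Fw 0 + Fw α' - Fw β' - Fw γ') * g * Δb := by
    rw [hZ'eq]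
    exact SlashInvariantForm.slash_action_eqn Zσ _ (Subgroup.mem_map_of_mem (Matrix.SpecialLinearGroup.mapGL ℝ) hγ₀)
  have hzero : ∀ τ : ℍ, ((Fw 0 + Fw α' - Fw β' - Fw γ') * g * Δb) τ = 0 := by
    intro τ
    have h := congrFun (hZ'neg.symm.trans hZ'inv) τ
    simp only [Pi.neg_apply] at h
    have : (2 : ℂ) * ((Fw 0 + Fw α' - Fw β' - Fw γ') * g * Δb) τ = 0 := by linear_combination -h
    simpa using this
  -- contradiction with `A' ≢ 0`
  obtain ⟨τ, -, hτ⟩ := exists_combination_ne_zero D G hG0 Fw hpres hα' hβ' hγ' hα'W hβ'W hγ'W 0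
  have h := hzero τ
  simp only [Pi.mul_apply] at h
  exact (mul_ne_zero (mul_ne_zero hτ (hgne τ)) (pow_ne_zero _ (ModularForm.discriminant_ne_zero τ))) h

end Summit.BirchSwinnertonDyer.BirchSwinnertonDyer.Theorems.ManinLocalTwoThree.CDivTranslate

end
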